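import Literature.Probability.FitznerVanDerHofstad2017.SrwIntegralBounds
import HarnessLib

/-!
# Positive-part bound for the consumers of `K_{n,l}(x)` (the "KPOS" lever)

CITATION HEADER (PLACEMENT v2). Part of the certified REPRODUCTION of
R. Fitzner, R. van der Hofstad, *Generalized approach to the non-backtracking lace expansion*,
Probab. Theory Related Fields 169 (2017) 1041–1119 [NoBLE17] (arXiv:1506.07969), §3.3.3 / §5.2, as
consumed by *Mean-field behavior for nearest-neighbor percolation in `d > 10`*, Electron. J. Probab. 22
(2017) no. 43 [FvdH17]. Origin: build `lace`, unit `b2b-lace-tail-g2` (divergence D39 "KSUP" of that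
build: the notebook's use of the `x = e₁` cell as `sup_{x ≠ 0} K_{n,l}(x)`).

## What is proved, and why

Every "blanket" consumer of `K_{n,l}(x)` in the percolation analysis ([NoBLE17] (3.36), p. 1071; the
bounds on open bubbles / triangles / squares and on `(2dz)^m (D^{⋆m} ⋆ G_z^{⋆n})(x)`) arises from an
integral of the shape

  `∫ D̂(k)^l D̂^{(x)}(k) g(k) dk/(2π)^d`,   `0 ≤ g ≤ c · Ĉ(k)ⁿ`  (a.e.),

where `g = Ĝ_z(k)ⁿ` is a power of the two-point function in Fourier space — NON-NEGATIVE for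
percolation by the Aizenman–Newman lemma `τ̂_p(k) ≥ 0` ([NoBLE17] text after Ass. 2.7: "`Ĝ_z(k) ≥ 0`";
[FvdH17] §4) — and `c = Γ₂'ⁿ` is the bootstrap bound `Ĝ_z ≤ Γ₂' Ĉ`. The printed estimate bounds the
integral by `c · K_{n,l}(x)` (absolute values everywhere). Since `g ≥ 0`, only the POSITIVE PART of the
signed weight `w = D̂^l D̂^{(x)}` can contribute, and `w⁺ = (w + |w|)/2`, whence the sharper

  `∫ D̂^l D̂^{(x)} g ≤ c · (I_{n,l}(x) + K_{n,l}(x)) / 2`        (`integral_weight_mul_le_half`),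

i.e. the arithmetic mean of the (computable, signed) `I_{n,l}(x)` and of any valid bound for `K_{n,l}(x)`
may replace `K_{n,l}(x)` in such a consumer. The file proves this for a general measurable weight
`|w| ≤ 1` (`integral_weight_mul_le_half_general`) and packages the `x = e_i` and `x = 0` instances with
the valid `K`-bounds of `SrwIntegralBounds` ((5.14): `K_{n,2j}(0) = I_{n,2j}(0)`,
`K_{n,2j+1}(0) ≤ √(I_{n,2j}(0) I_{n,2j+2}(0))`; `K_{n,l}(e_i) = K_{n,l+1}(0)`), plus the monotone glue
`kpos_of_le` / `srwK_le_sqrt_of_srwL_le` used when the pair `(I, K)` is replaced by upper bounds that are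
uniform in `x` (the sup-over-`x` step, which rests on the monotonicity of `I_{n,l}(x)` and `L_n(x)` in `x`,
[NoBLE17] Lemma 5.1 = Hara–Slade 1992b Lemmas B.3–B.4, NOT formalised here and entering only as the
hypotheses `hI`, `hK`, `hL`).

No hypothesis beyond the integrability range `d ≥ 2n + 1` and the stated a.e. bounds on `g`; no `sorry`.
-/

open MeasureTheory Real

namespace Literature.Probability.FitznerVanDerHofstad2017

open Literature.Barriers.CriticalPhenomena
open Literature.Barriers.CriticalPhenomena.Slade2006Prop53 (P)

variable {d : ℕ}

/-- Pointwise core of the positive-part bound: for `0 ≤ g ≤ c·C` one has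
`w·g ≤ c·(w·C + |w|·C)/2`. [folklore] -/
theorem mul_le_half_of_nonneg_le {w g c C : ℝ} (hg0 : 0 ≤ g) (hgc : g ≤ c * C) :
    w * g ≤ c * ((w * C + |w| * C) / 2) := by
  have h1 : w * g ≤ (w + |w|) / 2 * g := by
    have : w ≤ (w + |w|) / 2 := by have := le_abs_self w; linarith
    exact mul_le_mul_of_nonneg_right this hg0
  have h2 : (w + |w|) / 2 * g ≤ (w + |w|) / 2 * (c * C) := by
    have : 0 ≤ (w + |w|) / 2 := by have := neg_abs_le w; linarith
    exact mul_le_mul_of_nonneg_left hgc this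
  calc w * g ≤ (w + |w|) / 2 * (c * C) := h1.trans h2
    _ = c * ((w * C + |w| * C) / 2) := by ring

/-- **Positive-part bound, general weight.** For a measurable weight `|w| ≤ 1` and a measurable
`g` with `0 ≤ g ≤ c·Ĉⁿ` a.e. (`d ≥ 2n + 1`; no sign hypothesis on `c` is needed — for `c < 0` the
hypotheses are vacuous): `∫ w g ≤ c · (∫ w Ĉⁿ + ∫ |w| Ĉⁿ)/2`.
[cite: FitznerVanDerHofstad2016NoBLE, (3.36) p. 1071 and §5.2 p. 1091 (the consumers of `K_{n,l}`)] -/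
theorem integral_weight_mul_le_half_general {n : ℕ} (hd : 2 * n + 1 ≤ d)
    {w : (Fin d → ℝ) → ℝ} (hw : Measurable w) (hw1 : ∀ k, |w k| ≤ 1)
    {g : (Fin d → ℝ) → ℝ} (hg : Measurable g) (hg0 : ∀ᵐ k ∂P d, 0 ≤ g k)
    {c : ℝ} (hgc : ∀ᵐ k ∂P d, g k ≤ c * Chat d 1 k ^ n) :
    ∫ k, w k * g k ∂P d
      ≤ c * (((∫ k, w k * Chat d 1 k ^ n ∂P d) + ∫ k, |w k| * Chat d 1 k ^ n ∂P d) / 2) := by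
  have hI : Integrable (fun k => w k * Chat d 1 k ^ n) (P d) :=
    integrable_weight_mul_Chat_pow hd hw hw1
  have hK : Integrable (fun k => |w k| * Chat d 1 k ^ n) (P d) :=
    integrable_weight_mul_Chat_pow hd hw.abs fun k => by rw [abs_abs]; exact hw1 k
  have hC : Integrable (fun k => c * Chat d 1 k ^ n) (P d) :=
    (integrable_Chat_pow n hd zero_le_one le_rfl).const_mul c
  have hM : Integrable (fun k => c * ((w k * Chat d 1 k ^ n + |w k| * Chat d 1 k ^ n) / 2)) (P d) :=
    ((hI.add hK).div_const 2).const_mul c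
  have hwg : Integrable (fun k => w k * g k) (P d) := by
    refine Integrable.mono' hC (hw.mul hg).aestronglyMeasurable ?_
    filter_upwards [hg0, hgc] with k h0 hc'
    rw [Real.norm_eq_abs, abs_mul, abs_of_nonneg h0]
    calc |w k| * g k ≤ 1 * g k := mul_le_mul_of_nonneg_right (hw1 k) h0
      _ ≤ c * Chat d 1 k ^ n := by rw [one_mul]; exact hc'
  have hbound : ∀ᵐ k ∂P d,
      w k * g k ≤ c * ((w k * Chat d 1 k ^ n + |w k| * Chat d 1 k ^ n) / 2) := by
    filter_upwards [hg0, hgc] with k h0 hc'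
    exact mul_le_half_of_nonneg_le h0 hc'
  calc ∫ k, w k * g k ∂P d
      ≤ ∫ k, c * ((w k * Chat d 1 k ^ n + |w k| * Chat d 1 k ^ n) / 2) ∂P d :=
        integral_mono_ae hwg hM hbound
    _ = c * (((∫ k, w k * Chat d 1 k ^ n ∂P d) + ∫ k, |w k| * Chat d 1 k ^ n ∂P d) / 2) := by
        rw [integral_const_mul, integral_div, integral_add hI hK]

/-- `(2π)^d · I_{n,l}(x)` is the un-normalised `I`-integral. [folklore] -/
theorem integral_srwI_eq (n l : ℕ) (x : Fin d → ℤ) :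
    ∫ k, (Dhat d k ^ l * DhatSym d x k) * Chat d 1 k ^ n ∂P d = (2 * π) ^ d * srwI d n l x := by
  unfold srwI; field_simp

/-- `(2π)^d · K_{n,l}(x)` is the un-normalised `K`-integral. [folklore] -/
theorem integral_srwK_eq (n l : ℕ) (x : Fin d → ℤ) :
    ∫ k, (|Dhat d k| ^ l * |DhatSym d x k|) * Chat d 1 k ^ n ∂P d = (2 * π) ^ d * srwK d n l x := by
  unfold srwK; field_simp

/-- **Positive-part bound (KPOS).** For measurable `g` with `0 ≤ g ≤ c·Ĉⁿ` a.e.,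
`d ≥ 2n + 1`:  `∫ D̂^l D̂^{(x)} g dk/(2π)^d ≤ c · (I_{n,l}(x) + K_{n,l}(x))/2`.
In the NoBLE consumers `g = Ĝ_zⁿ ≥ 0` (Aizenman–Newman) and `c = Γ₂'ⁿ`; the printed estimate is
`c · K_{n,l}(x)`. [cite: FitznerVanDerHofstad2016NoBLE, (3.36) p. 1071, (5.9) p. 1091] -/
theorem integral_weight_mul_le_half {n : ℕ} (hd : 2 * n + 1 ≤ d) (l : ℕ) (x : Fin d → ℤ)
    {g : (Fin d → ℝ) → ℝ} (hg : Measurable g) (hg0 : ∀ᵐ k ∂P d, 0 ≤ g k)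
    {c : ℝ} (hgc : ∀ᵐ k ∂P d, g k ≤ c * Chat d 1 k ^ n) :
    (∫ k, (Dhat d k ^ l * DhatSym d x k) * g k ∂P d) / (2 * π) ^ d
      ≤ c * ((srwI d n l x + srwK d n l x) / 2) := by
  have hw : Measurable fun k => Dhat d k ^ l * DhatSym d x k :=
    ((continuous_Dhat d).measurable.pow_const l).mul (measurable_DhatSym d x)
  have hw1 : ∀ k, |Dhat d k ^ l * DhatSym d x k| ≤ 1 := fun k => by
    rw [abs_mul, abs_pow]
    exact mul_le_one₀ (abs_Dhat_pow_le_one l k) (abs_nonneg _) (abs_DhatSym_le_one x k)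
  have h := integral_weight_mul_le_half_general hd hw hw1 hg hg0 hgc
  have habs : (fun k => |Dhat d k ^ l * DhatSym d x k| * Chat d 1 k ^ n)
      = fun k => (|Dhat d k| ^ l * |DhatSym d x k|) * Chat d 1 k ^ n := by
    funext k; rw [abs_mul, abs_pow]
  rw [habs, integral_srwI_eq, integral_srwK_eq] at h
  have hpos := two_pi_pow_pos d
  rw [div_le_iff₀ hpos]
  calc ∫ k, (Dhat d k ^ l * DhatSym d x k) * g k ∂P d
      ≤ c * (((2 * π) ^ d * srwI d n l x + (2 * π) ^ d * srwK d n l x) / 2) := h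
    _ = c * ((srwI d n l x + srwK d n l x) / 2) * (2 * π) ^ d := by ring

/-- Monotone glue for the sup-over-`x` step: if `I_{n,l}(x) ≤ A` and `K_{n,l}(x) ≤ B` then the KPOS
bound is `≤ c·(A + B)/2`. (The uniform-in-`x` bounds `A`, `B` come from the monotonicity of
`I_{n,l}(x)`, `L_n(x)` in `x`, [NoBLE17] Lemma 5.1, supplied by the user as hypotheses.)
[cite: FitznerVanDerHofstad2016NoBLE, Lemma 5.1 p. 1098] -/
theorem kpos_of_le {n : ℕ} (hd : 2 * n + 1 ≤ d) (l : ℕ) (x : Fin d → ℤ)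
    {g : (Fin d → ℝ) → ℝ} (hg : Measurable g) (hg0 : ∀ᵐ k ∂P d, 0 ≤ g k)
    {c : ℝ} (hc : 0 ≤ c) (hgc : ∀ᵐ k ∂P d, g k ≤ c * Chat d 1 k ^ n)
    {A B : ℝ} (hI : srwI d n l x ≤ A) (hK : srwK d n l x ≤ B) :
    (∫ k, (Dhat d k ^ l * DhatSym d x k) * g k ∂P d) / (2 * π) ^ d ≤ c * ((A + B) / 2) :=
  (integral_weight_mul_le_half hd l x hg hg0 hgc).trans
    (mul_le_mul_of_nonneg_left (by linarith) hc)

/-- The Cauchy–Schwarz bound (5.9) is monotone in `L_n(x)`: if `L_n(x) ≤ L` then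
`K_{n,l}(x) ≤ √(I_{n,2l}(0)) · √L`. With `L = max(L_n(2e₁), L_n(e₁+e₂))` (Hara–Slade B.4 / [NoBLE17]
Lemma 5.1, hypothesis) this is the uniform bound over `‖x‖₂ > 1` used by Fitzner's thesis (5.2.40).
[cite: FitznerVanDerHofstad2016NoBLE, (5.9) p. 1091, Lemma 5.1 p. 1098] -/
theorem srwK_le_sqrt_of_srwL_le {n : ℕ} (hd : 2 * n + 1 ≤ d) (l : ℕ) (x : Fin d → ℤ) {L : ℝ}
    (hL : srwL d n x ≤ L) :
    srwK d n l x ≤ Real.sqrt (srwI d n (2 * l) 0) * Real.sqrt L :=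
  (srwK_le_sqrt_srwI_mul_srwL hd l x).trans
    (mul_le_mul_of_nonneg_left (Real.sqrt_le_sqrt hL) (Real.sqrt_nonneg _))

/-- KPOS at `x = e_i`, `l = 2j + 1` odd: `K_{n,2j+1}(e_i) = K_{n,2j+2}(0) = I_{n,2j+2}(0) = I_{n,2j+1}(e_i)`,
so the positive part gives nothing new: bound `c · I_{n,2j+2}(0)` (recorded for completeness — it shows
the `e₁`/odd cells of `SRW.nb` are already sharp). [cite: FitznerVanDerHofstad2016NoBLE, (5.14) p. 1092] -/
theorem kpos_single_odd {n : ℕ} (hd : 2 * n + 1 ≤ d) (j : ℕ) (i : Fin d)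
    {g : (Fin d → ℝ) → ℝ} (hg : Measurable g) (hg0 : ∀ᵐ k ∂P d, 0 ≤ g k)
    {c : ℝ} (hgc : ∀ᵐ k ∂P d, g k ≤ c * Chat d 1 k ^ n) :
    (∫ k, (Dhat d k ^ (2 * j + 1) * DhatSym d (Pi.single i 1) k) * g k ∂P d) / (2 * π) ^ d
      ≤ c * srwI d n (2 * j + 2) 0 := by
  have h := integral_weight_mul_le_half hd (2 * j + 1) (Pi.single i 1) hg hg0 hgc
  rw [srwI_single, srwK_single_odd] at h
  have e : 2 * j + 1 + 1 = 2 * j + 2 := by ring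
  rw [e] at h
  linarith

/-- KPOS at `x = e_i`, `l = 2j` even (the cells the notebook got wrong, gap G11): 
`∫ D̂^{2j} D̂^{(e_i)} g ≤ c · (I_{n,2j+1}(0) + √(I_{n,2j}(0) I_{n,2j+2}(0)))/2` — the mean of the
notebook's (invalid as a `K`-bound) value `I_{n,2j+1}(0)` and the valid geometric-mean bound.
[cite: FitznerVanDerHofstad2016NoBLE, (5.14) p. 1092] -/
theorem kpos_single_even {n : ℕ} (hd : 2 * n + 1 ≤ d) (j : ℕ) (i : Fin d)
    {g : (Fin d → ℝ) → ℝ} (hg : Measurable g) (hg0 : ∀ᵐ k ∂P d, 0 ≤ g k)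
    {c : ℝ} (hc : 0 ≤ c) (hgc : ∀ᵐ k ∂P d, g k ≤ c * Chat d 1 k ^ n) :
    (∫ k, (Dhat d k ^ (2 * j) * DhatSym d (Pi.single i 1) k) * g k ∂P d) / (2 * π) ^ d
      ≤ c * ((srwI d n (2 * j + 1) 0
          + Real.sqrt (srwI d n (2 * j) 0) * Real.sqrt (srwI d n (2 * j + 2) 0)) / 2) := by
  refine kpos_of_le hd (2 * j) (Pi.single i 1) hg hg0 hc hgc ?_ (srwK_single_even_le hd j i)
  rw [srwI_single]

/-- KPOS at `x = e_i` with ANY certified bound `B` for `K_{n,l+1}(0)` (e.g. the LP majorant cells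
`srwK_zero_le_d{d}_n{n}_m{m}` of `SrwIntegralMajorants`): `≤ c·(I_{n,l+1}(0) + B)/2`.
[cite: FitznerVanDerHofstad2016NoBLE, (3.36) p. 1071] -/
theorem kpos_single_of_le {n : ℕ} (hd : 2 * n + 1 ≤ d) (l : ℕ) (i : Fin d)
    {g : (Fin d → ℝ) → ℝ} (hg : Measurable g) (hg0 : ∀ᵐ k ∂P d, 0 ≤ g k)
    {c : ℝ} (hc : 0 ≤ c) (hgc : ∀ᵐ k ∂P d, g k ≤ c * Chat d 1 k ^ n)
    {B : ℝ} (hB : srwK d n (l + 1) 0 ≤ B) :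
    (∫ k, (Dhat d k ^ l * DhatSym d (Pi.single i 1) k) * g k ∂P d) / (2 * π) ^ d
      ≤ c * ((srwI d n (l + 1) 0 + B) / 2) := by
  refine kpos_of_le hd l (Pi.single i 1) hg hg0 hc hgc ?_ ?_
  · rw [srwI_single]
  · rw [srwK_single]; exact hB

/-- KPOS at `x = 0`, even `l = 2j`: `D̂^{(0)} = 1` and `K_{n,2j}(0) = I_{n,2j}(0)`, so the bound is
`c · I_{n,2j}(0)` (sharp: the weight `D̂^{2j} ≥ 0` has no negative part).
[cite: FitznerVanDerHofstad2016NoBLE, (5.14) p. 1092] -/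
theorem kpos_zero_even {n : ℕ} (hd : 2 * n + 1 ≤ d) (j : ℕ)
    {g : (Fin d → ℝ) → ℝ} (hg : Measurable g) (hg0 : ∀ᵐ k ∂P d, 0 ≤ g k)
    {c : ℝ} (hgc : ∀ᵐ k ∂P d, g k ≤ c * Chat d 1 k ^ n) :
    (∫ k, (Dhat d k ^ (2 * j) * DhatSym d 0 k) * g k ∂P d) / (2 * π) ^ d
      ≤ c * srwI d n (2 * j) 0 := by
  have h := integral_weight_mul_le_half hd (2 * j) 0 hg hg0 hgc
  rw [srwK_zero_even] at h
  linarith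

end Literature.Probability.FitznerVanDerHofstad2017
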